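import Literature.Algebra.Homology.ExactCoupleMorphisms
import HarnessLib

/-!
# Deligne's two-filtrations lemma on the pages of an exact couple (the `F_d = F_rec` half)

Topic `Literature/Algebra/Homology`, on top of `ExactCoupleEuler.lean` (pages `page ρ s q = E^{ρ+1}`,
differentials `dZ`, `E^{ρ+2} = H(E^{ρ+1}, d^{ρ+1})` as `dZ_eq_zero_iff` / `range_dZ`) and
`ExactCoupleMorphisms.lean` (morphisms `Hom`, page maps `pageMap`, naturality `pageMap_dZ`).

P. Deligne, *Théorie de Hodge II*, Publ. Math. IHÉS 40 (1971), 1.3.13–1.3.16 (and *Hodge III*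
7.2.4–7.2.8); the form followed here is E. Cattani, F. El Zein, P. Griffiths, Lê D. T., *Hodge
Theory* (Princeton Math. Notes 49, 2014), F. El Zein–Lê D. T., Ch. 3, Def. 3.2.26 (direct
filtration `F_d = Im (E_r(F^pK, W) → E_r(K, W))`), Def. 3.2.28 (recurrent filtration `F_rec`:
on `E_{r+1} = H(E_r, d_r)` the filtration induced by `F_rec` on `ker d_r`, then on the quotient)
and **Thm. 3.2.30 (two filtrations lemma)** with its proof by the inductive property
`(P_r)`: "`E_i(F^pK, W)` injects into `E_i(K, W)` for `i ≤ r` and its image is `F_rec` for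
`i ≤ r + 1`" (PDF pp. 165–167 of the held copy).

Abstract setting. A morphism of exact couples `Φ : C_p → C` (in the application: the map of
weight exact couples induced by the inclusion of filtered complexes `(F^pK, W) ⊆ (K, W)`). On the
page `E^{ρ+1}(C)` at `(s, q)` — the sub-quotient `Zr ρ s q / Br ρ s q` of `C.E s q` — a step of a
filtration is recorded by its SATURATED module of representatives `Br ρ ⊆ S ⊆ Zr ρ`:

* `Hom.Srec Φ ρ s q` — the representatives of the recurrent filtration `F_rec^p(E^{ρ+1})`:
  `Srec 0 = Im Φ` (on `E¹`; in the application `F_d = F_rec` on `E₁` is Lemma 3.2.27 plus the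
  hypothesis that `d₀` is strict, and is fed in as the injectivity hypothesis `hinj` below), and
  `Srec (ρ+1) = Srec ρ ∩ Z^{ρ+2} + B^{ρ+2}` (Def. 3.2.28 (ii): restrict to `ker d^{ρ+1}`, pass to
  the quotient); `Hom.pageRec` — the corresponding submodule of the page;
* `Hom.Rng Φ ρ s q = Φ(Z^{ρ+1}(C_p)) + B^{ρ+1}(C)` — the representatives of the direct filtration
  `F_d^p(E^{ρ+1}) = Im pageMap` (`range_pageMap_eq`);
* `Hom.StrictAt Φ ρ` — the hypothesis `(*)`: `d^{ρ+1}` is strictly compatible with `F_rec`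
  (`Im d ∩ F_rec ⊆ d(F_rec)`);
* `Hom.TwoFilt Φ ρ` — the property `(P_ρ)` at page `E^{ρ+1}`: all page maps
  `E^{ρ+1}(C_p) → E^{ρ+1}(C)` are injective and `F_d = F_rec` (`Rng = Srec`).

Results (all proved; no named fact):

* `Hom.twoFilt_zero` — `(P_0)` from the injectivity of `Φ` on `E¹`;
* **`Hom.twoFilt_succ`** — the inductive step `(P_ρ) ∧ (*ρ) ⟹ (P_{ρ+1})` (El Zein–Lê, proof of
  Thm. 3.2.30, PDF p. 167: strictness gives `d E(K) ∩ E(F^pK) = d E(F^pK)`, whence injectivity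
  on the next page; and `ker d ∩ F_rec = Φ(ker d)` by injectivity, whence `F_rec = F_d` on the
  next page);
* **`Hom.twoFilt_of_strict`** — Thm. 3.2.30 (i), first half: if `d^{i+1}` is strict for `F_rec`
  for all `i < r₀` (the hypothesis may use `(P_i)`, as in the application to mixed Hodge
  complexes where strictness at stage `i` comes from the purity established at stage `i`), then
  `(P_ρ)` holds for all `ρ ≤ r₀`;
* consequences under `(P_ρ)`: `range_pageMap_eq_pageRec` (`F_d = F_rec` on the page) and
  `dZ_mem_pageRec` (`d^{ρ+1}` is compatible with `F_rec`).

The dual half (`F_rec = F_{d*}`, exactness on the right) and parts (ii)–(iii) of Thm. 3.2.30 are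
not needed for the weak strictness criterion of the tree
(`HodgeTheory.range_le_range_of_hodgeType_span_gr`) and are not formalized here.

## References

* [DeligneHodgeII1971] P. Deligne, Théorie de Hodge II, Publ. Math. IHÉS 40 (1971), 1.3.13–1.3.17.
* [CattaniElZeinGriffithsLe2014] Hodge Theory, Princeton Math. Notes 49 (2014), Def. 3.2.26–Thm. 3.2.30.
* [Spanier1981] E. H. Spanier, Algebraic Topology (1981), Ch. 9, Sec. 1.
-/

noncomputable section

open Module Function

namespace Literature.Algebra.Homology

universe u v

variable {K : Type u} [DivisionRing K]

namespace HomologyExactCouple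

/-! ### Two small complements on the engine -/

section Engine

variable (C : HomologyExactCouple.{u, v} K)

/-- `d^{ρ+1}` kills the boundaries `B^{ρ+1}` (indeed `B^{ρ+1} ⊆ Z^{ρ+2} = ker d^{ρ+1}`). [folklore] -/
theorem dZ_eq_zero_of_mem_Br (ρ t q : ℕ) (z : C.Zr ρ (t + ρ + 1) (q + 1))
    (hz : (z : C.E (t + ρ + 1) (q + 1)) ∈ C.Br ρ (t + ρ + 1) (q + 1)) : C.dZ ρ t q z = 0 :=
  (C.dZ_eq_zero_iff ρ t q z).2 (C.Br_le_Zr ρ (ρ + 1) _ _ hz)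

/-- Off the sources of `d^{ρ+1}` (filtration `s ≤ ρ` or degree `0`) one has `Z^{ρ+2} = Z^{ρ+1}`;
at a source, `z ∈ Z^{ρ+2}` iff `d^{ρ+1} z = 0`. Packaged as: `z ∈ Z^{ρ+1}` lies in `Z^{ρ+2}` as
soon as `d^{ρ+1} z = 0` whenever `(s, q)` is a source. [folklore] -/
theorem mem_Zr_succ_of_dZ {ρ s q : ℕ} {z : C.E s q} (hz : z ∈ C.Zr ρ s q)
    (h : ∀ t q' (hs : s = t + ρ + 1) (hq : q = q' + 1),
      C.dZ ρ t q' ⟨hq ▸ hs ▸ z, by subst hs; subst hq; exact hz⟩ = 0) :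
    z ∈ C.Zr (ρ + 1) s q := by
  cases s with
  | zero => simp
  | succ s =>
    cases q with
    | zero => trivial
    | succ q =>
      by_cases hsρ : s + 1 ≤ ρ
      · rw [C.Zr_succ_eq_of_le hsρ]; exact hz
      · obtain ⟨t, rfl⟩ : ∃ t, s = t + ρ := ⟨s - ρ, by omega⟩
        exact (C.dZ_eq_zero_iff ρ t q ⟨z, hz⟩).1 (h t q rfl rfl)

end Engine

namespace Hom

variable {Cp C : HomologyExactCouple.{u, v} K} (Φ : Hom Cp C)

/-! ### The recurrent and the direct filtration steps on the pages -/

/-- **Representatives of the recurrent filtration step `F_rec^p(E^{ρ+1})`** on `C.E s q`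
(Deligne's `F_rec`, El Zein–Lê Def. 3.2.28, started at `E¹` with `F_rec = F_d = Im Φ`):
`Srec 0 = Im Φ`, `Srec (ρ+1) = Srec ρ ∩ Z^{ρ+2} + B^{ρ+2}`.
[cite: CattaniElZeinGriffithsLe2014, Def. 3.2.28] [cite: DeligneHodgeII1971, 1.3.13] -/
def Srec : ℕ → (s q : ℕ) → Submodule K (C.E s q)
  | 0, s, q => LinearMap.range (Φ.fE s q)
  | ρ + 1, s, q => Srec ρ s q ⊓ C.Zr (ρ + 1) s q ⊔ C.Br (ρ + 1) s q

/-- Unfolding `Srec 0`. [folklore] -/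
theorem Srec_zero (s q : ℕ) : Φ.Srec 0 s q = LinearMap.range (Φ.fE s q) := rfl

/-- Unfolding `Srec (ρ+1)`. [folklore] -/
theorem Srec_succ (ρ s q : ℕ) :
    Φ.Srec (ρ + 1) s q = Φ.Srec ρ s q ⊓ C.Zr (ρ + 1) s q ⊔ C.Br (ρ + 1) s q := rfl

/-- `B^{ρ+1} ⊆ Srec ρ` (saturation). [folklore] -/
theorem Br_le_Srec : ∀ ρ s q, C.Br ρ s q ≤ Φ.Srec ρ s q
  | 0, s, q => by rw [C.Br_zero]; exact bot_le
  | _ + 1, _, _ => le_sup_right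

/-- `Srec ρ ⊆ Z^{ρ+1}`. [folklore] -/
theorem Srec_le_Zr : ∀ ρ s q, Φ.Srec ρ s q ≤ C.Zr ρ s q
  | 0, s, q => by rw [C.Zr_zero]; exact le_top
  | ρ + 1, s, q => sup_le inf_le_right (C.Br_le_Zr (ρ + 1) (ρ + 1) s q)

/-- **Representatives of the direct filtration step `F_d^p(E^{ρ+1}) = Im (E^{ρ+1}(C_p) → E^{ρ+1}(C))`**:
`Φ(Z^{ρ+1}(C_p)) + B^{ρ+1}(C)`. [cite: CattaniElZeinGriffithsLe2014, Def. 3.2.26] -/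
def Rng (ρ s q : ℕ) : Submodule K (C.E s q) := (Cp.Zr ρ s q).map (Φ.fE s q) ⊔ C.Br ρ s q

/-- `Rng ρ ⊆ Z^{ρ+1}`. [folklore] -/
theorem Rng_le_Zr (ρ s q : ℕ) : Φ.Rng ρ s q ≤ C.Zr ρ s q :=
  sup_le (Φ.map_Zr_le ρ s q) (C.Br_le_Zr ρ ρ s q)

/-- `B^{ρ+1} ⊆ Rng ρ` (saturation). [folklore] -/
theorem Br_le_Rng (ρ s q : ℕ) : C.Br ρ s q ≤ Φ.Rng ρ s q := le_sup_right

/-- The submodule of the page `E^{ρ+1} = Z/B` cut out by a module of representatives `S`. [folklore] -/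
def pageSub (ρ s q : ℕ) (S : Submodule K (C.E s q)) : Submodule K (C.page ρ s q) :=
  (S.comap (C.Zr ρ s q).subtype).map ((C.Br ρ s q).comap (C.Zr ρ s q).subtype).mkQ

omit Φ in
/-- `[z] ∈ pageSub S` iff `z ≡ w (mod B)` for some `w ∈ S ∩ Z`; for `S ⊇ B` simply iff `z ∈ S`. [folklore] -/
theorem mk_mem_pageSub_iff {ρ s q : ℕ} {S : Submodule K (C.E s q)} (hBS : C.Br ρ s q ≤ S)
    (z : C.Zr ρ s q) : Submodule.Quotient.mk z ∈ pageSub ρ s q S ↔ (z : C.E s q) ∈ S := by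
  constructor
  · rintro ⟨w, hw, hwz⟩
    rw [Submodule.mkQ_apply, Submodule.Quotient.eq] at hwz
    have h : (z : C.E s q) = w - (w - z : C.Zr ρ s q) := by simp
    rw [h]
    exact S.sub_mem hw (hBS hwz)
  · intro hz
    exact ⟨z, hz, rfl⟩

/-- **The recurrent filtration step on the page** `F_rec^p(E^{ρ+1}_{s,q})`.
[cite: CattaniElZeinGriffithsLe2014, Def. 3.2.28] -/
def pageRec (ρ s q : ℕ) : Submodule K (C.page ρ s q) := pageSub ρ s q (Φ.Srec ρ s q)

/-- `[z] ∈ F_rec` iff `z ∈ Srec`. [folklore] -/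
theorem mk_mem_pageRec_iff {ρ s q : ℕ} (z : C.Zr ρ s q) :
    Submodule.Quotient.mk z ∈ Φ.pageRec ρ s q ↔ (z : C.E s q) ∈ Φ.Srec ρ s q :=
  mk_mem_pageSub_iff (Φ.Br_le_Srec ρ s q) z

/-- **`Im pageMap = F_d`**: the range of the page map is cut out by `Rng`. [cite: CattaniElZeinGriffithsLe2014, Def. 3.2.26] -/
theorem range_pageMap_eq (ρ s q : ℕ) :
    LinearMap.range (Φ.pageMap ρ s q) = pageSub ρ s q (Φ.Rng ρ s q) := by
  ext x
  obtain ⟨z, rfl⟩ := Submodule.Quotient.mk_surjective _ x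
  rw [mk_mem_pageSub_iff (Φ.Br_le_Rng ρ s q), Φ.mk_mem_range_pageMap_iff]
  constructor
  · rintro ⟨y, hy, hyz⟩
    have h : (z : C.E s q) = Φ.fE s q y - (Φ.fE s q y - z) := by abel
    rw [h]
    exact (Φ.Rng ρ s q).sub_mem (Submodule.mem_sup_left ⟨y, hy, rfl⟩) (Submodule.mem_sup_right hyz)
  · intro hz
    obtain ⟨_, ⟨y, hy, rfl⟩, b, hb, hyb⟩ := Submodule.mem_sup.1 hz
    refine ⟨y, hy, ?_⟩
    rw [← hyb, sub_add_cancel_left]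
    exact (C.Br ρ s q).neg_mem hb

/-- `[z] ∈ Im pageMap` iff `z ∈ Rng`. [folklore] -/
theorem mk_mem_range_pageMap_iff' {ρ s q : ℕ} (z : C.Zr ρ s q) :
    Submodule.Quotient.mk z ∈ LinearMap.range (Φ.pageMap ρ s q) ↔ (z : C.E s q) ∈ Φ.Rng ρ s q := by
  rw [range_pageMap_eq, mk_mem_pageSub_iff (Φ.Br_le_Rng ρ s q)]

/-! ### The property `(P_ρ)` and the strictness hypothesis `(*ρ)` -/

/-- **`(P_ρ)` at the page `E^{ρ+1}`**: every page map `E^{ρ+1}(C_p) → E^{ρ+1}(C)` is injective,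
and its image is the recurrent filtration step (`F_d = F_rec`, as modules of representatives).
[cite: CattaniElZeinGriffithsLe2014, proof of Thm. 3.2.30] -/
def TwoFilt (ρ : ℕ) : Prop :=
  (∀ s q, Injective (Φ.pageMap ρ s q)) ∧ ∀ s q, Φ.Rng ρ s q = Φ.Srec ρ s q

/-- **`(*ρ)`: the differential `d^{ρ+1}` is strictly compatible with `F_rec`** —
`Im d^{ρ+1} ∩ F_rec ⊆ d^{ρ+1}(F_rec)`. [cite: CattaniElZeinGriffithsLe2014, Thm. 3.2.30 (*r₀)] -/
def StrictAt (ρ : ℕ) : Prop :=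
  ∀ t q, LinearMap.range (C.dZ ρ t q) ⊓ Φ.pageRec ρ t q ≤
    ((Φ.Srec ρ (t + ρ + 1) (q + 1)).comap (C.Zr ρ (t + ρ + 1) (q + 1)).subtype).map (C.dZ ρ t q)

/-- Under `(P_ρ)`: `Im pageMap = F_rec` on the page. [cite: CattaniElZeinGriffithsLe2014, Thm. 3.2.30 (i)] -/
theorem range_pageMap_eq_pageRec {ρ : ℕ} (h : Φ.TwoFilt ρ) (s q : ℕ) :
    LinearMap.range (Φ.pageMap ρ s q) = Φ.pageRec ρ s q := by
  rw [range_pageMap_eq, pageRec, h.2 s q]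

/-- Under `(P_ρ)`: `d^{ρ+1}` maps `F_rec`-cycles into `F_rec` (compatibility of `d_r` with
`F_rec = F_d`, El Zein–Lê Prop. 3.2.29 (iii)). [cite: CattaniElZeinGriffithsLe2014, Prop. 3.2.29 (iii)] -/
theorem dZ_mem_pageRec {ρ : ℕ} (h : Φ.TwoFilt ρ) (t q : ℕ) (z : C.Zr ρ (t + ρ + 1) (q + 1))
    (hz : (z : C.E _ _) ∈ Φ.Srec ρ (t + ρ + 1) (q + 1)) : C.dZ ρ t q z ∈ Φ.pageRec ρ t q := by
  rw [← h.2, Rng] at hz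
  obtain ⟨_, ⟨y, hy, rfl⟩, b, hb, hyb⟩ := Submodule.mem_sup.1 hz
  have hfy : Φ.fE _ _ y ∈ C.Zr ρ (t + ρ + 1) (q + 1) := Φ.map_Zr_le ρ _ _ ⟨y, hy, rfl⟩
  have hbZ : b ∈ C.Zr ρ (t + ρ + 1) (q + 1) := C.Br_le_Zr ρ ρ _ _ hb
  have hsplit : z = ⟨Φ.fE _ _ y, hfy⟩ + ⟨b, hbZ⟩ := Subtype.ext hyb.symm
  rw [hsplit, map_add, C.dZ_eq_zero_of_mem_Br ρ t q ⟨b, hbZ⟩ hb, add_zero,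
    ← Φ.pageMap_dZ ρ t q ⟨y, hy⟩, ← Φ.range_pageMap_eq_pageRec h]
  exact LinearMap.mem_range_self _ _

/-! ### The induction -/

/-- **`(P_0)`**: on `E¹ = E` the page map is `Φ` itself, so it is injective when `Φ` is, and
`F_d = Im Φ = F_rec` by definition. [cite: CattaniElZeinGriffithsLe2014, proof of Thm. 3.2.30] -/
theorem twoFilt_zero (hinj : ∀ s q, Injective (Φ.fE s q)) : Φ.TwoFilt 0 := by
  refine ⟨fun s q ↦ (Φ.injective_pageMap_iff 0 s q).2 fun z _ hz ↦ ?_, fun s q ↦ ?_⟩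
  · rw [C.Br_zero, Submodule.mem_bot] at hz
    rw [Cp.Br_zero, Submodule.mem_bot]
    exact hinj s q (by rw [hz, map_zero])
  · rw [Rng, Srec_zero, C.Br_zero, Cp.Zr_zero, Submodule.map_top, sup_bot_eq]

/-- **The inductive step `(P_ρ) ∧ (*ρ) ⟹ (P_{ρ+1})`** (El Zein–Lê, proof of Thm. 3.2.30, PDF
p. 167). Injectivity on `E^{ρ+2}`: if `Φ y` is a `d^{ρ+1}`-boundary, `Φ y = d x`, strictness of
`d` for `F_rec = Im Φ` gives `Φ y = d (Φ y') = Φ (d y')` up to `B^{ρ+1}`, and injectivity on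
`E^{ρ+1}` gives `y ≡ d y'`, a boundary. Image on `E^{ρ+2}`: `F_rec = (F_rec ∩ ker d) + B`, and
`ker d ∩ Φ(Z) = Φ(ker d)` by naturality and injectivity on `E^{ρ+1}`.
[cite: CattaniElZeinGriffithsLe2014, Thm. 3.2.30] [cite: DeligneHodgeII1971, 1.3.16] -/
theorem twoFilt_succ {ρ : ℕ} (hP : Φ.TwoFilt ρ) (hS : Φ.StrictAt ρ) : Φ.TwoFilt (ρ + 1) := by
  have hinjρ : ∀ s q, ∀ z ∈ Cp.Zr ρ s q, Φ.fE s q z ∈ C.Br ρ s q → z ∈ Cp.Br ρ s q :=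
    fun s q ↦ (Φ.injective_pageMap_iff ρ s q).1 (hP.1 s q)
  refine ⟨fun s q ↦ (Φ.injective_pageMap_iff (ρ + 1) s q).2 fun y hy hfy ↦ ?_, fun s q ↦ ?_⟩
  · -- injectivity on the next page
    have hyρ : y ∈ Cp.Zr ρ s q := Cp.Zr_succ_le ρ s q hy
    have hfyZ : Φ.fE s q y ∈ C.Zr ρ s q := Φ.map_Zr_le ρ s q ⟨y, hyρ, rfl⟩
    -- `[Φ y]` is a `d^{ρ+1}`-boundary of `C` …
    have hrange : Submodule.Quotient.mk ⟨Φ.fE s q y, hfyZ⟩ ∈ LinearMap.range (C.dZ ρ s q) := by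
      rw [C.range_dZ]
      exact ⟨⟨Φ.fE s q y, hfyZ⟩, hfy, rfl⟩
    -- … lying in `F_rec = F_d`
    have hrec : Submodule.Quotient.mk ⟨Φ.fE s q y, hfyZ⟩ ∈ Φ.pageRec ρ s q := by
      rw [mk_mem_pageRec_iff, ← hP.2]
      exact Submodule.mem_sup_left ⟨y, hyρ, rfl⟩
    -- strictness: it is `d x'` with `x' ∈ Srec = Rng`, `x' = Φ y' + b`
    obtain ⟨x', hx'S, hx'd⟩ := hS s q ⟨hrange, hrec⟩
    have hx'R : ((x' : C.E _ _)) ∈ Φ.Rng ρ (s + ρ + 1) (q + 1) := by rw [hP.2]; exact hx'S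
    obtain ⟨_, ⟨y', hy', rfl⟩, b, hb, hyb⟩ := Submodule.mem_sup.1 hx'R
    have hfy' : Φ.fE _ _ y' ∈ C.Zr ρ (s + ρ + 1) (q + 1) := Φ.map_Zr_le ρ _ _ ⟨y', hy', rfl⟩
    have hbZ : b ∈ C.Zr ρ (s + ρ + 1) (q + 1) := C.Br_le_Zr ρ ρ _ _ hb
    have hsplit : x' = ⟨Φ.fE _ _ y', hfy'⟩ + ⟨b, hbZ⟩ := Subtype.ext hyb.symm
    rw [hsplit, map_add, C.dZ_eq_zero_of_mem_Br ρ s q ⟨b, hbZ⟩ hb, add_zero,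
      ← Φ.pageMap_dZ ρ s q ⟨y', hy'⟩] at hx'd
    -- `d y' = [w₁]` with `w₁ ∈ B^{ρ+2}(C_p)`
    have hdy' : Cp.dZ ρ s q ⟨y', hy'⟩ ∈ LinearMap.range (Cp.dZ ρ s q) := LinearMap.mem_range_self _ _
    rw [Cp.range_dZ] at hdy'
    obtain ⟨w₁, hw₁B, hw₁⟩ := hdy'
    rw [← hw₁, Submodule.mkQ_apply, pageMap_mk, Submodule.Quotient.eq] at hx'd
    -- injectivity on `E^{ρ+1}`: `w₁ - y ∈ B^{ρ+1}(C_p)`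
    have hdiff : (w₁ : Cp.E s q) - y ∈ Cp.Br ρ s q := by
      refine hinjρ s q _ ((Cp.Zr ρ s q).sub_mem w₁.2 hyρ) ?_
      rw [map_sub]
      exact hx'd
    have hy_eq : y = w₁ - ((w₁ : Cp.E s q) - y) := by abel
    rw [hy_eq]
    exact (Cp.Br (ρ + 1) s q).sub_mem hw₁B (Cp.Br_succ ρ s q hdiff)
  · -- the image on the next page
    apply le_antisymm
    · -- `Rng (ρ+1) ≤ Srec (ρ+1)`
      rw [Srec_succ, ← hP.2]
      refine sup_le_sup_right ?_ _
      exact le_inf ((Submodule.map_mono (Cp.Zr_succ_le ρ s q)).trans le_sup_left)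
        (Φ.map_Zr_le (ρ + 1) s q)
    · -- `Srec (ρ+1) ≤ Rng (ρ+1)`
      rw [Srec_succ, ← hP.2]
      refine sup_le ?_ (le_sup_right.trans' (le_refl _))
      rintro x ⟨hxR, hxZ⟩
      obtain ⟨_, ⟨y, hy, rfl⟩, b, hb, hyb⟩ := Submodule.mem_sup.1 hxR
      have hfyZ : Φ.fE s q y ∈ C.Zr (ρ + 1) s q := by
        have h : Φ.fE s q y = x - b := by rw [← hyb]; abel
        rw [h]
        exact (C.Zr (ρ + 1) s q).sub_mem hxZ (C.Br_le_Zr ρ (ρ + 1) s q hb)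
      -- `y ∈ Z^{ρ+2}(C_p)`: by injectivity of the page map at the target of `d^{ρ+1}`
      have hyZ : y ∈ Cp.Zr (ρ + 1) s q := by
        refine Cp.mem_Zr_succ_of_dZ hy fun t q' hs hq ↦ ?_
        subst hs; subst hq
        apply hP.1 t q'
        rw [map_zero, Φ.pageMap_dZ]
        exact (C.dZ_eq_zero_iff ρ t q' _).2 hfyZ
      rw [← hyb]
      exact Submodule.add_mem_sup ⟨y, hyZ, rfl⟩ (C.Br_succ ρ s q hb)

/-- **Deligne's two-filtrations lemma, `F_d = F_rec` half** (El Zein–Lê Thm. 3.2.30 (i), first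
assertion; Deligne, Hodge II, 1.3.16): if `Φ` is injective on `E¹` and, for every `i < r₀`, the
differential `d^{i+1}` is strictly compatible with the recurrent filtration — a hypothesis which
may use `(P_i)` — then `(P_ρ)` holds for every `ρ ≤ r₀`: the page maps
`E^{ρ+1}(C_p) → E^{ρ+1}(C)` are injective with image `F_rec`.
[cite: CattaniElZeinGriffithsLe2014, Thm. 3.2.30] [cite: DeligneHodgeII1971, 1.3.16] -/
theorem twoFilt_of_strict (hinj : ∀ s q, Injective (Φ.fE s q)) (r₀ : ℕ)
    (hS : ∀ i < r₀, Φ.TwoFilt i → Φ.StrictAt i) : ∀ ρ ≤ r₀, Φ.TwoFilt ρ := by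
  intro ρ
  induction ρ with
  | zero => exact fun _ ↦ Φ.twoFilt_zero hinj
  | succ ρ ih =>
    intro hρ
    have hP := ih (Nat.le_of_succ_le hρ)
    exact Φ.twoFilt_succ hP (hS ρ hρ hP)

/-- The same without a bound: strictness at every stage gives `(P_ρ)` for all `ρ`.
[cite: CattaniElZeinGriffithsLe2014, Thm. 3.2.30 (iii)] -/
theorem twoFilt_of_strict' (hinj : ∀ s q, Injective (Φ.fE s q))
    (hS : ∀ i, Φ.TwoFilt i → Φ.StrictAt i) (ρ : ℕ) : Φ.TwoFilt ρ :=
  Φ.twoFilt_of_strict hinj ρ (fun i _ h ↦ hS i h) ρ le_rfl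

end Hom

end HomologyExactCouple

end Literature.Algebra.Homology

end
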